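import Summits.CriticalPhenomena.PercolationContinuityZ3.Theorems.PercNearOneGluingNoHeavyLowerTailSunflowerBottomSlack
import HarnessLib
import HarnessLib.Audit

/-!
# `NoHeavyLowerTail` (crux stmt-CriticalPhenomena-4575), abstract sunflower cubic: the strengthened partition lemma (★_B)
# `BottomSlackPaysRainbows` HOLDS FOR EVERY SUNFLOWER WITH AN INTERSECTING PETAL 1 — rank–nullity on the bottom-spectator supplies only

Support file (seat `prim-l12-p2` gen 20; `--supports stmt-CriticalPhenomena-4575`).  No `sorry`, no new definitions.
Memo: run/shared/lean/prim/prim-l12/prim-l12-p2/FINDING-g20-COMPLEMENT-READING.md §4, §1(b).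

(★_B) (`…SunflowerBottomSlack`): `#rainbows ≤ Σ_{lab S = 0} (#AB(Sᶜ) − #CR(Sᶜ))` — the Gladkov slack of the BOTTOM-spectator cubes alone pays
for the rainbows (census-clean incl. n ≤ 5 exhaustive; implies ★).  Here it is PROVED for sunflowers whose petal 1 is an intersecting family:
the explicit left inverse `kB_rbVec` of gen 20 lives on the bottom-spectator supplies, so the restrictions of the two-stage rainbow vectors to
`sup_B = {σ ∈ sup : lab σ.2 = 0}` (= their TS-B parts) are linearly independent there; they are orthogonal to the bottom-spectator rows
(`rbVec_orth`), which are independent (`specRows_indep`) and number `Σ_{lab S = 0} #CR(Sᶜ)`; and `#sup_B = Σ_{lab S = 0} #AB(Sᶜ)`.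

* `Sunflower.card_supB_eq`, `Sunflower.card_demB_eq` — the two counts;
* `Sunflower.tsB_linearIndependent_of_intersecting` — independence of the restricted rainbow vectors on `sup_B`;
* `Sunflower.bottomSlack_of_intersecting_petal_one` — **(★_B) for an intersecting petal 1**:
  `(rainbowCard : ℤ) ≤ Σ_{lab S = 0} cubeSlack Sᶜ`.
-/

namespace Summit.CriticalPhenomena.PercolationContinuityZ3.Theorems.SunflowerPartition

open Finset

namespace Sunflower

variable {α : Type*} [Fintype α] [DecidableEq α] (F : Sunflower α)

/-! ## Counting the bottom-spectator supplies and demands -/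

/-- `#sup_B = Σ_{lab S = 0} #AB(Sᶜ)`. [this work] -/
theorem card_supB_eq :
    (F.sup.filter (fun σ => F.lab σ.2 = 0)).card
      = ∑ S ∈ (Finset.univ : Finset (Finset α)).filter (fun S => F.lab S = 0), F.abCard Sᶜ := by
  rw [Finset.card_eq_sum_card_fiberwise (f := fun σ : Finset α × Finset α => σ.2) (t := (Finset.univ : Finset (Finset α)))
    (fun _ _ => mem_coe.2 (mem_univ _))]
  rw [Finset.sum_filter]
  refine sum_congr rfl fun S _ => ?_
  by_cases hS : F.lab S = 0
  · rw [if_pos hS]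
    have : (F.sup.filter (fun σ => F.lab σ.2 = 0)).filter (fun σ => σ.2 = S) = F.sup.filter (fun σ => σ.2 = S) := by
      ext σ; simp only [mem_filter]
      constructor
      · rintro ⟨⟨h1, -⟩, h3⟩; exact ⟨h1, h3⟩
      · rintro ⟨h1, h3⟩; exact ⟨⟨h1, by rw [h3]; exact hS⟩, h3⟩
    rw [this, F.card_sup_fiber S, if_pos (Or.inr hS)]
  · rw [if_neg hS, Finset.card_eq_zero, Finset.filter_eq_empty_iff]
    intro σ hσ h3
    exact hS (h3 ▸ (mem_filter.1 hσ).2)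

/-- `#(non-rainbow demands with a bottom spectator) = Σ_{lab S = 0} #CR(Sᶜ)`. [this work] -/
theorem card_demB_eq :
    ((F.dem.filter (fun d => ¬ F.IsRainbow d)).filter (fun d => F.lab d.1 = 0)).card
      = ∑ S ∈ (Finset.univ : Finset (Finset α)).filter (fun S => F.lab S = 0), F.crCard Sᶜ := by
  rw [Finset.card_eq_sum_card_fiberwise (f := fun d : Finset α × Finset α => d.1) (t := (Finset.univ : Finset (Finset α)))
    (fun _ _ => mem_coe.2 (mem_univ _))]
  rw [Finset.sum_filter]
  refine sum_congr rfl fun S _ => ?_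
  by_cases hS : F.lab S = 0
  · rw [if_pos hS]
    have : ((F.dem.filter (fun d => ¬ F.IsRainbow d)).filter (fun d => F.lab d.1 = 0)).filter (fun d => d.1 = S)
        = (F.dem.filter (fun d => ¬ F.IsRainbow d)).filter (fun d => d.1 = S) := by
      ext d; simp only [mem_filter]
      constructor
      · rintro ⟨⟨h1, -⟩, h3⟩; exact ⟨h1, h3⟩
      · rintro ⟨h1, h3⟩; exact ⟨⟨h1, by rw [h3]; exact hS⟩, h3⟩
    rw [this, F.card_dem_spec_fiber S, if_pos (Or.inr hS)]
  · rw [if_neg hS, Finset.card_eq_zero, Finset.filter_eq_empty_iff]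
    intro d hd h3
    exact hS (h3 ▸ (mem_filter.1 hd).2)

/-! ## The TS-B parts are independent when petal 1 is intersecting -/

/-- **Independence of the restricted rainbow vectors** (this work): if petal 1 is intersecting, the restrictions of the `rbVec ρ` to the
bottom-spectator supplies `sup_B` are linearly independent — the left inverse `kB_rbVec` is supported on `sup_B`. [this work] -/
theorem tsB_linearIndependent_of_intersecting
    (hint : ∀ D D' : Finset α, F.lab D = 1 → F.lab D' = 1 → (D ∩ D').Nonempty) :
    LinearIndependent (ZMod 2)
      (fun ρ : ↥(F.dem.filter (fun d => F.IsRainbow d)) => fun σ : ↥(F.sup.filter (fun σ => F.lab σ.2 = 0)) => F.rbVec ρ.1 σ.1) := by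
  rw [Fintype.linearIndependent_iff]
  intro g hg ρ'
  have hρ' : ρ'.1 ∈ F.dem := (mem_filter.1 ρ'.2).1
  have hr' : F.IsRainbow ρ'.1 := (mem_filter.1 ρ'.2).2
  set supB := F.sup.filter (fun σ => F.lab σ.2 = 0) with hsupB
  -- the certificate functional of `ρ'` (supported on `sup_B`)
  let filtS := ((ρ'.1.1 ∪ ρ'.1.2)ᶜ).powerset.filter (fun S => F.lab S = 0 ∧ F.lab (ρ'.1.1ᶜ \ S) = 4)
  let kB : Finset α × Finset α → ZMod 2 := fun σ =>
    ∑ S ∈ filtS, F.certN ρ'.1 S *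
      (if σ.2 = S then
        ∑ R' ∈ (Sᶜ).powerset, (if F.lab R' = 0 ∧ (σ.1 ∪ σ.2)ᶜ ⊆ R' ∧ R' ⊆ Sᶜ \ ρ'.1.1 then (1 : ZMod 2) else 0)
       else 0)
  have hkB0 : ∀ σ ∈ F.sup, σ ∉ supB → kB σ = 0 := by
    intro σ hσ hσB
    refine sum_eq_zero fun S hS => ?_
    rw [if_neg, mul_zero]
    intro h
    exact hσB (mem_filter.2 ⟨hσ, by rw [h]; exact (mem_filter.1 hS).2.1⟩)
  have hpt : ∀ σ : ↥supB, (∑ ρ, g ρ * F.rbVec ρ.1 σ.1) = 0 := by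
    intro σ
    have := congrFun hg σ
    simpa [Finset.sum_apply, Pi.smul_apply, smul_eq_mul] using this
  have h0 : (∑ σ : ↥supB, kB σ.1 * (∑ ρ, g ρ * F.rbVec ρ.1 σ.1)) = 0 :=
    sum_eq_zero fun σ _ => by rw [hpt σ, mul_zero]
  rw [show (∑ σ : ↥supB, kB σ.1 * (∑ ρ, g ρ * F.rbVec ρ.1 σ.1))
      = ∑ ρ, g ρ * (∑ σ : ↥supB, kB σ.1 * F.rbVec ρ.1 σ.1) by
    rw [show (∑ σ : ↥supB, kB σ.1 * (∑ ρ, g ρ * F.rbVec ρ.1 σ.1))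
        = ∑ σ : ↥supB, ∑ ρ, g ρ * (kB σ.1 * F.rbVec ρ.1 σ.1) from
      sum_congr rfl fun σ _ => by rw [Finset.mul_sum]; exact sum_congr rfl fun ρ _ => by ring]
    rw [Finset.sum_comm]
    exact sum_congr rfl fun ρ _ => by rw [Finset.mul_sum]] at h0
  have hpair : ∀ ρ : ↥(F.dem.filter (fun d => F.IsRainbow d)),
      (∑ σ : ↥supB, kB σ.1 * F.rbVec ρ.1 σ.1) = if ρ = ρ' then 1 else 0 := by
    intro ρ
    rw [Finset.sum_coe_sort supB (fun σ => kB σ * F.rbVec ρ.1 σ)]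
    have hfull := F.kB_rbVec hint (mem_filter.1 ρ.2).1 (mem_filter.1 ρ.2).2 hρ' hr'
    -- the sum over `sup` equals the sum over `sup_B`
    have hrestr : (∑ σ ∈ F.sup, kB σ * F.rbVec ρ.1 σ) = ∑ σ ∈ supB, kB σ * F.rbVec ρ.1 σ := by
      rw [hsupB, Finset.sum_filter]
      refine sum_congr rfl fun σ hσ => ?_
      by_cases h : F.lab σ.2 = 0
      · rw [if_pos h]
      · rw [if_neg h, hkB0 σ hσ (fun h' => h (mem_filter.1 h').2), zero_mul]
    simp only [kB] at hfull hrestr ⊢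
    rw [← hrestr, hfull]
    by_cases h : ρ = ρ'
    · rw [if_pos h, if_pos (congrArg Subtype.val h)]
    · rw [if_neg h, if_neg fun h' => h (Subtype.ext h')]
  rw [sum_congr rfl fun ρ _ => by rw [hpair ρ]] at h0
  simp only [mul_ite, mul_one, mul_zero, Finset.sum_ite_eq', Finset.mem_univ, if_true] at h0
  exact h0

/-! ## (★_B) for an intersecting petal 1 -/

/-- **(★_B) FOR AN INTERSECTING PETAL 1** (this work): if any two label-1 sets meet, then
`#rainbows ≤ Σ_{lab S = 0} (#AB(Sᶜ) − #CR(Sᶜ))`.  Rank–nullity in `GF(2)^{sup_B}`: the bottom-spectator rows are independent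
(`specRows_indep`, extended by zero) and number `Σ_{lab S=0} #CR(Sᶜ)`; the restricted rainbow vectors are independent
(`tsB_linearIndependent_of_intersecting`), lie in the kernel (`rbVec_orth`) and number `#rainbows`; `#sup_B = Σ_{lab S=0} #AB(Sᶜ)`.
[this work] -/
theorem bottomSlack_of_intersecting_petal_one
    (hint : ∀ D D' : Finset α, F.lab D = 1 → F.lab D' = 1 → (D ∩ D').Nonempty) :
    (F.rainbowCard : ℤ) ≤ ∑ S ∈ (Finset.univ : Finset (Finset α)).filter (fun S => F.lab S = 0), F.cubeSlack Sᶜ := by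
  classical
  set supB := F.sup.filter (fun σ => F.lab σ.2 = 0) with hsupB
  set SPB := (F.dem.filter (fun d => ¬ F.IsRainbow d)).filter (fun d => F.lab d.1 = 0) with hSPB
  set RB := F.dem.filter (fun d => F.IsRainbow d) with hRB
  let R : Matrix ↥SPB ↥supB (ZMod 2) := Matrix.of fun d σ => F.specRow d.1 σ.1
  -- (1) the rows of `R` are independent (cube theorem, via `specRows_indep` with the coefficients extended by zero)
  have hinj : Function.Injective (Matrix.mulVecLin R.transpose) := by
    rw [← LinearMap.ker_eq_bot, LinearMap.ker_eq_bot']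
    intro g hg
    let c : Finset α × Finset α → ZMod 2 := fun d => if hd : d ∈ SPB then g ⟨d, hd⟩ else 0
    have hc : ∀ σ ∈ F.sup, (∑ d ∈ F.dem.filter (fun d => ¬ F.IsRainbow d), c d * F.specRow d σ) = 0 := by
      intro σ hσ
      -- demands outside `SPB` have coefficient zero
      have hsplit : (∑ d ∈ F.dem.filter (fun d => ¬ F.IsRainbow d), c d * F.specRow d σ) = ∑ d ∈ SPB, c d * F.specRow d σ := by
        symm
        refine Finset.sum_subset (by rw [hSPB]; exact Finset.filter_subset _ _) fun d _ hdn => ?_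
        simp only [c, dif_neg hdn, zero_mul]
      rw [hsplit]
      by_cases hσB : σ ∈ supB
      · have h0 : (R.transpose.mulVec g) ⟨σ, hσB⟩ = 0 :=
          congrFun (show R.transpose.mulVec g = 0 from (Matrix.mulVecLin_apply R.transpose g).symm.trans hg) ⟨σ, hσB⟩
        simp only [Matrix.mulVec, dotProduct, Matrix.transpose_apply, R, Matrix.of_apply] at h0
        rw [← Finset.sum_coe_sort SPB]
        refine Eq.trans (sum_congr rfl fun x _ => ?_) h0
        simp only [c, dif_pos x.2]
        ring
      · -- a kernel-spectator supply: every bottom-spectator row vanishes there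
        refine sum_eq_zero fun d hd => ?_
        have hd0 : F.lab d.1 = 0 := (mem_filter.1 hd).2
        have hne : σ.2 ≠ d.1 := fun h => hσB (mem_filter.2 ⟨hσ, by rw [h]; exact hd0⟩)
        unfold specRow
        rw [if_neg hne, mul_zero]
    have hz := F.specRows_indep c hc
    funext x
    have := hz x.1 (mem_filter.1 x.2).1
    simp only [c, dif_pos x.2] at this
    rw [this, Pi.zero_apply]
  -- (2) rank of the row map
  have hrank : Module.finrank (ZMod 2) (LinearMap.range (Matrix.mulVecLin R)) = Fintype.card ↥SPB := by
    have h1 : R.rank = R.transpose.rank := (Matrix.rank_transpose R).symm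
    unfold Matrix.rank at h1
    rw [h1, LinearMap.finrank_range_of_inj hinj, Module.finrank_fintype_fun_eq_card]
  -- (3) the restricted rainbow vectors lie in the kernel
  have hker : Submodule.span (ZMod 2) (Set.range (fun ρ : ↥RB => fun σ : ↥supB => F.rbVec ρ.1 σ.1))
      ≤ LinearMap.ker (Matrix.mulVecLin R) := by
    rw [Submodule.span_le]
    rintro v ⟨ρ, rfl⟩
    rw [SetLike.mem_coe, LinearMap.mem_ker, Matrix.mulVecLin_apply]
    funext d
    simp only [Matrix.mulVec, dotProduct, R, Matrix.of_apply, Pi.zero_apply]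
    have horth := F.rbVec_orth (mem_filter.1 ρ.2).1 (mem_filter.1 ρ.2).2 (mem_filter.1 (mem_filter.1 d.2).1).1
      (mem_filter.1 (mem_filter.1 d.2).1).2
    have hd0 : F.lab d.1.1 = 0 := (mem_filter.1 d.2).2
    have hrestr : (∑ σ ∈ F.sup, F.specRow d.1 σ * F.rbVec ρ.1 σ) = ∑ σ ∈ supB, F.specRow d.1 σ * F.rbVec ρ.1 σ := by
      rw [hsupB, Finset.sum_filter]
      refine sum_congr rfl fun σ _ => ?_
      by_cases h : F.lab σ.2 = 0
      · rw [if_pos h]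
      · rw [if_neg h]
        have hne : σ.2 ≠ d.1.1 := fun h' => h (by rw [h']; exact hd0)
        unfold specRow
        rw [if_neg hne, zero_mul]
    rw [hrestr, ← Finset.sum_coe_sort supB] at horth
    exact horth
  -- (4) count dimensions
  have hli := F.tsB_linearIndependent_of_intersecting hint
  have hT : Module.finrank (ZMod 2)
      (Submodule.span (ZMod 2) (Set.range (fun ρ : ↥RB => fun σ : ↥supB => F.rbVec ρ.1 σ.1))) = Fintype.card ↥RB :=
    finrank_span_eq_card hli
  have hrn := LinearMap.finrank_range_add_finrank_ker (Matrix.mulVecLin R)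
  rw [Module.finrank_fintype_fun_eq_card, hrank] at hrn
  have hle := Submodule.finrank_mono hker
  rw [hT] at hle
  have hcards : Fintype.card ↥SPB + Fintype.card ↥RB ≤ Fintype.card ↥supB := by omega
  rw [Fintype.card_coe, Fintype.card_coe, Fintype.card_coe] at hcards
  rw [hSPB, F.card_demB_eq, hsupB, F.card_supB_eq] at hcards
  have hRBc : RB.card = F.rainbowCard := rfl
  rw [hRBc] at hcards
  unfold cubeSlack
  rw [Finset.sum_sub_distrib]
  have : ((∑ S ∈ (Finset.univ : Finset (Finset α)).filter (fun S => F.lab S = 0), F.crCard Sᶜ) + F.rainbowCard : ℤ)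
      ≤ ((∑ S ∈ (Finset.univ : Finset (Finset α)).filter (fun S => F.lab S = 0), F.abCard Sᶜ : ℕ) : ℤ) := by exact_mod_cast hcards
  push_cast at this
  linarith

end Sunflower

end Summit.CriticalPhenomena.PercolationContinuityZ3.Theorems.SunflowerPartition
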